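import Summits.ValiantsHypothesis.ValiantsHypothesis.Theorems.KPlusLogSqLawTropicalBCyclePotentialMass

/-!
# Route «KPlusLogSqLaw», crux `TropicalB` (stmt-ValiantsHypothesis-19771) — the JUMP LAW: only CARRIES (class-histogram jumps) cost potential
# `n ≤ #J + (2c+1)^K·(m + Σ_{k∈J} #{class-changing columns at k})`, `J` ⊇ the steps whose class histogram moves by more than `c` unit replacements

HONEST FRAMING.  Helper toward the registered stubs `stub_tropThin` / `stub_tropFat` of `Cruxes/TropicalB/Lines/birth.lean` (crux
`Summit.ValiantsHypothesis.ValiantsHypothesis.Theses.KPlusLogSqLaw.TropicalB`, item stmt-ValiantsHypothesis-19771, route KPlusLogSqLaw; cell `pub-symmetroid`, seat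
val-sym-trop-p1 g25, 2026-08-29; `--supports … --as helper`).  A STRUCTURE law for dominant chains of ARBITRARY designs; it does not bound `TropicalB` in its
window and bears on neither `WeakLifting`, DoorA26 / DoorA34, `MatrixDescartes` (stmt-ValiantsHypothesis-18050) nor VP ≠ VNP.

The CLASS HISTOGRAM of a term is `l ↦ #{b : λ b = l}`; a step's JUMP is the `ℓ¹`-distance of consecutive histograms (`2` for one unit replacement).  The cycle
potential law (p677819 / p684651) exempted the steps with SHORT ORBITS; the point of this file is that the orbit structure is irrelevant: because the SLOPE
`Σ_l d_l·hist_l` rises at every step (`TropicalCensus.slope_lt_of_dominant`), a `c`-compatible potential in DIFFERENCE form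
(`CompatHeight.exists_small_compatible`: `0 ≤ u ≤ (2c+1)^K`, `⟨d,δ⟩ ≥ 1 ⇒ ⟨u,δ⟩ ≥ 1` for `Σ|δ| ≤ 2c`) rises at EVERY step whose jump is `≤ 2c` — however
long its exchange cycle.

* `telescope_le` — abstract bookkeeping: if `Φ` climbs by `≥ 1` at every step outside `J`, then `n ≤ #J + (Φ_n − Φ_0) + Σ_{k∈J}(Φ_k − Φ_{k+1})`.
* `hist_sum`, `jump_step` — `Σ_b w(λ b) = Σ_l w_l·hist_l`; for dominant `p ≠ p'` at `θ < θ'` with jump `≤ 2c`: `Φ_u(p) + 1 ≤ Φ_u(p')`.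
* **`chain_le_jumps`** — for every design, chain and `J ⊇ {k : jump_k > 2c}`: **`n ≤ #J + (2c+1)^K·(m + Σ_{k∈J} #{b : class of b changes at step k})`**.
  At `c = 1` (`H = 3^K ≤ 2^{1.6K}`): the chain is paid for by the CARRIES (steps whose histogram moves by more than one unit replacement) and their class
  mass — TB-shape in EVERY regime (`3^K·m ≤ 2^{1.6K + log₂ m + 1}`); the crux-facing iff «`TropicalB` ⟺ few carries» is the companion file
  `…TropicalBCarries`.
READING.  With the local pattern law (`…LocalPatternLaw`: steps with short cycles are polynomially few) the residual of the crux is the class-mass of the LONG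
CARRIES: steps whose single exchange cycle has more than `max(⌊log₂m⌋, K/⌊log₂m⌋)` columns AND whose class histogram jumps — the odometer carries of every
known construction (located: GRW (11,4) has 18 steps with jump > 4, the rotations; the counting-tight (5,4) chain jumps by ≥ 4 at 48 of its 55 steps).
[this cell's law]
-/

set_option linter.dupNamespace false
set_option autoImplicit false

namespace Summit.ValiantsHypothesis.ValiantsHypothesis.Theorems.KPlusLogSqLaw

open Summit.ValiantsHypothesis.ValiantsHypothesis.Theorems.MatrixDescartes.Negative
open Summit.ValiantsHypothesis.ValiantsHypothesis.Theorems.LacunarySymmetroidMatrixDescartes.TropicalCensus (slope_lt_of_dominant)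
open scoped BigOperators
open Finset

namespace Jumps

/-- **Telescoping with exceptions**: if `Φ (k+1) ≥ Φ k + 1` for every step `k ∉ J`, then
`n ≤ #J + (Φ n − Φ 0) + Σ_{k∈J} (Φ k − Φ (k+1))`. [folklore] -/
theorem telescope_le {n : ℕ} (Φ : Fin (n + 1) → ℤ) (J : Finset (Fin n))
    (hclimb : ∀ k : Fin n, k ∉ J → Φ k.castSucc + 1 ≤ Φ k.succ) :
    (n : ℤ) ≤ J.card + (Φ (Fin.last n) - Φ 0) + ∑ k ∈ J, (Φ k.castSucc - Φ k.succ) := by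
  classical
  -- the telescoping sum
  have htel : ∑ k : Fin n, (Φ k.succ - Φ k.castSucc) = Φ (Fin.last n) - Φ 0 := by
    set g : ℕ → ℤ := fun i => Φ ⟨min i n, Nat.lt_succ_of_le (Nat.min_le_right i n)⟩ with hg
    have h2 : ∀ k : Fin n, (Φ k.succ - Φ k.castSucc) = g ((k : ℕ) + 1) - g (k : ℕ) := by
      intro k
      have ha : (⟨min ((k : ℕ) + 1) n, Nat.lt_succ_of_le (Nat.min_le_right _ n)⟩ : Fin (n + 1)) = k.succ :=
        Fin.ext (by simp)
      have hb : (⟨min (k : ℕ) n, Nat.lt_succ_of_le (Nat.min_le_right _ n)⟩ : Fin (n + 1)) = k.castSucc :=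
        Fin.ext (by simp)
      rw [hg]; simp only; rw [ha, hb]
    rw [sum_congr rfl fun k _ => h2 k, Fin.sum_univ_eq_sum_range (fun i => g (i + 1) - g i) n, Finset.sum_range_sub]
    have hn : (⟨min n n, Nat.lt_succ_of_le (Nat.min_le_right n n)⟩ : Fin (n + 1)) = Fin.last n := Fin.ext (by simp)
    have h0 : (⟨min 0 n, Nat.lt_succ_of_le (Nat.min_le_right 0 n)⟩ : Fin (n + 1)) = 0 := Fin.ext (by simp)
    rw [hg]; simp only; rw [hn, h0]
  -- split over `J` and its complement
  have hsplit := (sum_filter_add_sum_filter_not univ (fun k : Fin n => k ∈ J) (fun k => Φ k.succ - Φ k.castSucc)).symm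
  have hJ : (univ.filter fun k : Fin n => k ∈ J) = J := by ext k; simp
  rw [hJ] at hsplit
  have hcomp : (((univ.filter fun k : Fin n => ¬ k ∈ J)).card : ℤ) ≤
      ∑ k ∈ univ.filter (fun k : Fin n => ¬ k ∈ J), (Φ k.succ - Φ k.castSucc) := by
    have h := sum_le_sum (s := univ.filter fun k : Fin n => ¬ k ∈ J) (f := fun _ => (1 : ℤ))
      (g := fun k => Φ k.succ - Φ k.castSucc) fun k hk => by
        have := hclimb k (mem_filter.mp hk).2; linarith
    rw [sum_const, nsmul_eq_mul, mul_one] at h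
    exact h
  have hcard : ((univ.filter fun k : Fin n => ¬ k ∈ J).card : ℤ) + J.card = n := by
    have h := Finset.card_filter_add_card_filter_not (s := (univ : Finset (Fin n))) (fun k => k ∈ J)
    rw [hJ, card_univ, Fintype.card_fin] at h
    linarith [h]
  have hJsum : ∑ k ∈ J, (Φ k.succ - Φ k.castSucc) = -∑ k ∈ J, (Φ k.castSucc - Φ k.succ) := by
    rw [← sum_neg_distrib]; exact sum_congr rfl fun k _ => by ring
  rw [htel] at hsplit
  linarith

variable {m K : ℕ}

/-- class sums through the histogram: `Σ_b w(λ b) = Σ_l w_l · #{b : λ b = l}`. [folklore] -/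
theorem hist_sum (lam : Fin m → Fin K) (w : Fin K → ℤ) :
    ∑ b, w (lam b) = ∑ l, w l * ((univ.filter fun b => lam b = l).card : ℤ) :=
  CyclePotential.sum_comp_eq_sum_mul_card univ lam w

variable (d : Fin K → ℕ) (v ε : Fin m → Fin m → Fin K → ℤ)

/-- **JUMP STEP.**  For a `c`-compatible potential in difference form and two dominant terms `p ≠ p'` at slopes `θ < θ'` whose class histograms differ by
at most `2c` in `ℓ¹`, the potential climbs: `Φ_u(p) + 1 ≤ Φ_u(p')`.  No hypothesis on the exchange cycle. [this cell's law] -/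
theorem jump_step (c : ℕ) (u : Fin K → ℤ)
    (hu : ∀ δ : Fin K → ℤ, (∑ l, |δ l|) ≤ 2 * c → 1 ≤ ∑ l, (d l : ℤ) * δ l → 1 ≤ ∑ l, u l * δ l)
    {θ θ' : ℤ} (hθ : θ < θ') {p p' : Equiv.Perm (Fin m) × (Fin m → Fin K)} (hne : p ≠ p')
    (hp : IsDominant d v ε θ p) (hp' : IsDominant d v ε θ' p')
    (hjump : (∑ l, |((univ.filter fun b => p'.2 b = l).card : ℤ) - ((univ.filter fun b => p.2 b = l).card : ℤ)|) ≤ 2 * c) :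
    ∑ b, u (p.2 b) + 1 ≤ ∑ b, u (p'.2 b) := by
  classical
  set δ : Fin K → ℤ := fun l => ((univ.filter fun b => p'.2 b = l).card : ℤ) - ((univ.filter fun b => p.2 b = l).card : ℤ) with hδ
  have key : ∀ w : Fin K → ℤ, ∑ b, w (p'.2 b) - ∑ b, w (p.2 b) = ∑ l, w l * δ l := by
    intro w
    rw [hist_sum p'.2 w, hist_sum p.2 w, ← sum_sub_distrib]
    exact sum_congr rfl fun l _ => by rw [hδ]; ring
  have hslope : ∑ i, (d (p.2 i) : ℤ) < ∑ i, (d (p'.2 i) : ℤ) := slope_lt_of_dominant d v ε hθ hne hp hp'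
  have hd1 : 1 ≤ ∑ l, (d l : ℤ) * δ l := by rw [← key (fun l => (d l : ℤ))]; linarith
  have h := hu δ hjump hd1
  rw [← key u] at h
  linarith

/-- **THE JUMP LAW.**  In every design, for every chain of terms dominant at strictly increasing slopes with consecutive terms distinct and every set `J`
containing the steps whose class histogram moves by more than `2c` in `ℓ¹`:
`n ≤ #J + (2c+1)^K · (m + Σ_{k∈J} #{b : class of b changes at step k})`. [this cell's law] -/
theorem chain_le_jumps (c : ℕ) {n : ℕ} (θ : Fin (n + 1) → ℤ) (p : Fin (n + 1) → Equiv.Perm (Fin m) × (Fin m → Fin K))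
    (hθ : StrictMono θ) (hdom : ∀ k, IsDominant d v ε (θ k) (p k)) (hne : ∀ k : Fin n, p k.castSucc ≠ p k.succ)
    (J : Finset (Fin n))
    (hjump : ∀ k : Fin n, k ∉ J →
      (∑ l, |((univ.filter fun b => (p k.succ).2 b = l).card : ℤ) - ((univ.filter fun b => (p k.castSucc).2 b = l).card : ℤ)|) ≤ 2 * c) :
    (n : ℤ) ≤ J.card + (((2 * c + 1) ^ K : ℕ) : ℤ) *
      (m + ∑ k ∈ J, ((univ.filter fun b => (p k.castSucc).2 b ≠ (p k.succ).2 b).card : ℤ)) := by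
  classical
  obtain ⟨u, hU, hu⟩ := CompatHeight.exists_small_compatible K c d
  set H : ℤ := (((2 * c + 1) ^ K : ℕ) : ℤ) with hH
  have hU' : ∀ l, (0 : ℤ) ≤ u l ∧ u l ≤ H := fun l => ⟨(hU l).1, by rw [hH]; push_cast; exact (hU l).2⟩
  set Φ : Fin (n + 1) → ℤ := fun k => ∑ b, u ((p k).2 b) with hΦ
  have htel := telescope_le Φ J fun k hk =>
    jump_step d v ε c u hu (hθ Fin.castSucc_lt_succ) (hne k) (hdom _) (hdom _) (hjump k hk)
  -- the potential range and the resets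
  have hrange : Φ (Fin.last n) - Φ 0 ≤ H * m := by
    have h1 : Φ (Fin.last n) ≤ ∑ _b : Fin m, H := sum_le_sum fun b _ => (hU' _).2
    have h0 : 0 ≤ Φ 0 := sum_nonneg fun b _ => (hU' _).1
    rw [sum_const, card_univ, Fintype.card_fin, nsmul_eq_mul] at h1
    linarith
  have hresets : ∑ k ∈ J, (Φ k.castSucc - Φ k.succ) ≤
      ∑ k ∈ J, H * ((univ.filter fun b => (p k.castSucc).2 b ≠ (p k.succ).2 b).card : ℤ) := by
    refine sum_le_sum fun k _ => ?_
    have h := CyclePotential.potential_drop_le_card_mul u 0 H hU' (p k.castSucc).2 (p k.succ).2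
    rw [sub_zero] at h
    exact h
  rw [← mul_sum] at hresets
  nlinarith [hresets, hrange, htel, show (0 : ℤ) ≤ H by positivity]

end Jumps

end Summit.ValiantsHypothesis.ValiantsHypothesis.Theorems.KPlusLogSqLaw
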